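import Literature.MathematicalPhysics.QuantumManyBody.PeriodicFeynmanKacFormUpper
import Literature.MathematicalPhysics.QuantumManyBody.GroundStateFeynmanKacTrialState
import HarnessLib

/-!
# Periodic Feynman–Kac: symmetric smooth periodic trial functions and the variational identification

Topic `Literature/MathematicalPhysics/QuantumManyBody`; theorems only. Support file for the proof
of the named fact `Literature.MathematicalPhysics.QuantumManyBody.BoseGas.PeriodicGroundStateFeynmanKac`
(`PeriodicHeatFlowSpectral.lean`), torus twin of `GroundStateFeynmanKacTrialState.lean` and of
Part III of `GroundStateFeynmanKacProofs.lean` (variational identification of the top of the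
spectrum, Chung–Zhao (1995) Thm 3.27 / Prop 3.29, on the torus: the density step "smooth periodic
functions are dense in the form domain", done concretely). From a continuous, nonnegative,
permutation-symmetric PERIODIC `Ψ₀` we build the **mollified** function `ρ_r ⋆ Ψ₀`
(`mollify` of the Dirichlet file; no dilation is needed on the torus, which has no boundary):
it is `C¹`, periodic (`mollify_periodic`), permutation symmetric, nonnegative and bounded like
`Ψ₀`, and

* `setLIntegral_cellN_realKinetic_mollify_le` — its kinetic energy on the cell is controlled by
  the free small-time form of `Ψ₀`: if eventually `sqIncrCell t Ψ₀/(2t) ≤ K'` then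
  `∫_cell |∇ (ρ_r ⋆ Ψ₀)|² ≤ K'` (Fatou lower bound and mollification monotonicity of
  `PeriodicFeynmanKacFreeForm`);
* `abs_mollify_sub_le_of_periodic` — `sup |ρ_r ⋆ Ψ₀ - Ψ₀| ≤ η` for `r` small (uniform continuity);
* **`periodicGroundStateEnergy_le_ofReal_of_eigen`** — if moreover `∫_cell Ψ₀² = 1` and
  `e^{-λt} ≤ ⟨Ψ₀, e^{-tH}Ψ₀⟩_cell` for all `t > 0`, then `periodicGroundStateEnergy v N L ≤ λ`
  (the normalised `ρ_r ⋆ Ψ₀` are periodic trial states with energies eventually below `λ + ε`);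
* **`periodicGroundStateEnergy_eq_ofReal_of_feynmanKac`**, `periodicGroundStateEnergy_toReal_eq_of_feynmanKac` — together with
  `ofReal_le_periodicGroundStateEnergy_of_pairing_le` (`PeriodicFeynmanKacEnergyLower`):
  `periodicGroundStateEnergy v N L = ENNReal.ofReal λ`.

## References

* K. L. Chung, Z. Zhao, *From Brownian Motion to Schrödinger's Equation* (1995), Thm 3.27,
  Prop 3.29 (81) and its proof. [ChungZhao1995]
* S. Fournais, *Length scales for BEC in the dilute Bose gas* (2021), (1.1)–(1.2). [Fournais2020]
-/

noncomputable section

namespace Literature.MathematicalPhysics.QuantumManyBody.BoseGas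

open MeasureTheory Filter Set
open scoped ENNReal NNReal Topology Convolution

variable {N : ℕ}

/-! ### Mollification of periodic functions -/

/-- **Mollification preserves periodicity.** [folklore] -/
theorem mollify_periodic {r : ℝ} (hr : 0 < r) {L : ℝ} {g : Config N → ℝ}
    (hper : ∀ (X : Config N) (i : Fin N) (k : Fin 3),
      g (X + Pi.single i (EuclideanSpace.single k L)) = g X)
    (X : Config N) (i : Fin N) (k : Fin 3) :
    mollify hr g (X + Pi.single i (EuclideanSpace.single k L)) = mollify hr g X := by
  unfold mollify
  refine integral_congr_ae (Eventually.of_forall fun Y => ?_)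
  simp only
  rw [add_sub_right_comm, hper]

/-- **Mollification approximates a continuous periodic function uniformly**: for `η > 0` there is
`r₀ > 0` with `|(ρ_r ⋆ Ψ₀)(X) - Ψ₀(X)| ≤ η` for all `X` and all `0 < r ≤ r₀`. [folklore] -/
theorem abs_mollify_sub_le_of_periodic {L : ℝ} (hL : 0 < L) {Ψ₀ : Config N → ℝ} (hcont : Continuous Ψ₀)
    (hper : ∀ (X : Config N) (i : Fin N) (k : Fin 3),
      Ψ₀ (X + Pi.single i (EuclideanSpace.single k L)) = Ψ₀ X)
    {η : ℝ} (hη : 0 < η) :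
    ∃ r₀ > 0, ∀ (r : ℝ) (hr : 0 < r), r ≤ r₀ → ∀ X, |mollify hr Ψ₀ X - Ψ₀ X| ≤ η := by
  obtain ⟨M, -, hM⟩ := exists_bound_of_continuous_periodic hL hcont hper
  obtain ⟨δ, hδ, hUC⟩ := periodic_uniformContinuous hL hcont hper hη
  refine ⟨δ / 2, half_pos hδ, fun r hr hrδ X => ?_⟩
  refine abs_mollify_sub_le hr hcont.measurable hM fun Y hY => ?_
  have := hUC X (-Y) (by rw [norm_neg]; linarith)
  rwa [← sub_eq_add_neg] at this

/-- **The kinetic energy of the mollified function is controlled by the free small-time form of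
`Ψ₀`**: if eventually `sqIncrCell t Ψ₀ / (2t) ≤ K'` as `t → 0⁺` (for a bounded measurable periodic
`Ψ₀`), then `∫_cell |∇ (ρ_r ⋆ Ψ₀)|² ≤ K'` (Fatou lower bound for the `C¹` periodic mollification and
mollification monotonicity of `sqIncrCell`). [cite: ChungZhao1995, Prop 3.29 (81)] -/
theorem setLIntegral_cellN_realKinetic_mollify_le {L : ℝ} (hL : 0 < L) {r : ℝ} (hr : 0 < r)
    {Ψ₀ : Config N → ℝ} (hcont : Continuous Ψ₀)
    (hper : ∀ (X : Config N) (i : Fin N) (k : Fin 3),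
      Ψ₀ (X + Pi.single i (EuclideanSpace.single k L)) = Ψ₀ X)
    {M : ℝ} (hM : ∀ X, |Ψ₀ X| ≤ M) {K' : ℝ}
    (hev : ∀ᶠ t : ℝ≥0 in 𝓝[>] 0, (ENNReal.ofReal (2 * t))⁻¹ * sqIncrCell L t Ψ₀ ≤ ENNReal.ofReal K') :
    ∫⁻ X in cellN N L, realKinetic (mollify hr Ψ₀) X ≤ ENNReal.ofReal K' := by
  have hΨm : Measurable Ψ₀ := hcont.measurable
  set φ := mollify hr Ψ₀ with hφ
  have hφC : ContDiff ℝ 1 φ := contDiff_mollify hr hcont.locallyIntegrable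
  -- Step 1: Fatou
  refine (kinetic_le_liminf_sqIncrCell L hφC).trans ?_
  -- Step 2: an eventual bound of the rescaled increments of `φ`
  have hbound : ∀ᶠ t : ℝ≥0 in 𝓝[>] 0, (ENNReal.ofReal (2 * t))⁻¹ * sqIncrCell L t φ ≤ ENNReal.ofReal K' := by
    filter_upwards [hev] with t ht
    have h1 : sqIncrCell L t φ ≤ sqIncrCell L t Ψ₀ := by
      have hrepr : φ = fun x => ∫ y, Ψ₀ (x - y) ∂mollifierMeasure hr := by
        funext x; exact mollify_eq_integral_measure hr Ψ₀ x
      rw [hrepr]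
      exact sqIncrCell_conv_le hL hΨm hM hper _ t
    exact (mul_le_mul' le_rfl h1).trans ht
  -- Step 3: liminf ≤ eventual bound
  calc liminf (fun t : ℝ≥0 => (ENNReal.ofReal (2 * t))⁻¹ * sqIncrCell L t φ) (𝓝[>] 0)
      ≤ liminf (fun _ : ℝ≥0 => ENNReal.ofReal K') (𝓝[>] 0) := liminf_le_liminf hbound
    _ = ENNReal.ofReal K' := liminf_const _

/-! ### The energy of the trial state -/

/-- `‖(r : ℂ)‖₊² = ofReal (r²)`.  Same statement as `ennnorm_real_sq`
(`PeriodicBoseGasJastrow.lean`); kept under this name (many Summits files `rw` with it) as a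
one-line pointer (dedup-01326) — prefer `ennnorm_real_sq` in new code. [folklore] -/
theorem ennnorm_sq_ofReal_periodic (r : ℝ) : ((‖(r : ℂ)‖₊ : ℝ≥0∞)) ^ 2 = ENNReal.ofReal (r ^ 2) :=
  ennnorm_real_sq r

/-- Scaling of the real kinetic density: `|∇(cφ)|² = c² |∇φ|²`. [folklore] -/
theorem realKinetic_const_mul_periodic {φ : Config N → ℝ} (hφ : Differentiable ℝ φ) (c : ℝ) (X : Config N) :
    realKinetic (fun Y => c * φ Y) X = ENNReal.ofReal (c ^ 2) * realKinetic φ X := by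
  unfold realKinetic
  have hd : fderiv ℝ (fun Y => c * φ Y) X = c • fderiv ℝ φ X :=
    ((hφ X).hasFDerivAt.const_mul c).fderiv
  rw [hd, Finset.mul_sum]
  refine Finset.sum_congr rfl fun i _ => ?_
  rw [Finset.mul_sum]
  refine Finset.sum_congr rfl fun k _ => ?_
  rw [show (c • fderiv ℝ φ X) (Pi.single i (EuclideanSpace.single k (1 : ℝ))) =
      c * fderiv ℝ φ X (Pi.single i (EuclideanSpace.single k (1 : ℝ))) from rfl, nnnorm_mul, ENNReal.coe_mul,
    mul_pow, ← ENNReal.coe_pow, ← ENNReal.ofReal_coe_nnreal]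
  congr 1
  push_cast
  rw [Real.norm_eq_abs, sq_abs]

/-- **The periodic energy of a real-scaled trial state**: if the wave function of the periodic
trial state `Ψ` is `c · φ` for a real `C¹` function `φ`, then
`𝓔^per[Ψ] = c² · (∫_cell|∇φ|² + ∫_cell φ² V^per)`. [cite: Fournais2020, (1.1)] -/
theorem periodicEnergy_of_ofReal_mul {L : ℝ} (Ψ : PeriodicTrialState N L) {c : ℝ} {φ : Config N → ℝ}
    (hφC : ContDiff ℝ 1 φ) (hΨ : Ψ.ψ = fun X => (((c * φ X : ℝ)) : ℂ)) (v : ℝ → ℝ≥0∞) :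
    periodicEnergy v Ψ = ENNReal.ofReal (c ^ 2) *
      ((∫⁻ X in cellN N L, realKinetic φ X) + ∫⁻ X in cellN N L, ENNReal.ofReal (φ X ^ 2) * periodicInteraction v L X) := by
  have hφd : Differentiable ℝ φ := hφC.differentiable one_ne_zero
  have hcφd : Differentiable ℝ fun Y => c * φ Y := (differentiable_const c).mul hφd
  have hkin : ∀ X, kineticDensity Ψ.ψ X = ENNReal.ofReal (c ^ 2) * realKinetic φ X := by
    intro X
    rw [hΨ, kineticDensity_ofReal hcφd, realKinetic_const_mul_periodic hφd]
  have hnorm : ∀ X, ((‖Ψ.ψ X‖₊ : ℝ≥0∞)) ^ 2 = ENNReal.ofReal (c ^ 2) * ENNReal.ofReal (φ X ^ 2) := by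
    intro X
    rw [hΨ, ennnorm_sq_ofReal_periodic, mul_pow, ENNReal.ofReal_mul (sq_nonneg _)]
  unfold periodicEnergy
  simp_rw [hkin, hnorm]
  have h1 : ∀ X, ENNReal.ofReal (c ^ 2) * realKinetic φ X +
      periodicInteraction v L X * (ENNReal.ofReal (c ^ 2) * ENNReal.ofReal (φ X ^ 2)) =
      ENNReal.ofReal (c ^ 2) * (realKinetic φ X + ENNReal.ofReal (φ X ^ 2) * periodicInteraction v L X) := by
    intro X; ring
  simp_rw [h1]
  rw [lintegral_const_mul' _ _ ENNReal.ofReal_ne_top, lintegral_add_left (measurable_realKinetic hφC)]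

/-! ### `periodicGroundStateEnergy ≤ λ` from the integrated eigen-relation -/

/-- Real form of the mass of a difference of squares with a bounded weight on the cell:
`|∫_cell (φ² - Ψ₀²) w| ≤ B · vol(cell) · 2M · s` when `sup|φ - Ψ₀| ≤ s`, `|φ|, |Ψ₀| ≤ M`, `|w| ≤ B`.
[folklore] -/
theorem abs_setIntegral_cellN_sq_sub_sq_mul_le {L : ℝ} {φ Ψ₀ w : Config N → ℝ}
    {M s B : ℝ} (hs0 : 0 ≤ s) (hφM : ∀ X, |φ X| ≤ M) (hΨM : ∀ X, |Ψ₀ X| ≤ M)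
    (hw : ∀ X, |w X| ≤ B) (hsup : ∀ X, |φ X - Ψ₀ X| ≤ s) :
    |∫ X in cellN N L, (φ X ^ 2 - Ψ₀ X ^ 2) * w X| ≤ B * (volume (cellN N L)).toReal * (2 * M) * s := by
  have hB0 : 0 ≤ B := (abs_nonneg _).trans (hw 0)
  have hM0 : 0 ≤ M := (abs_nonneg _).trans (hφM 0)
  have hpt : ∀ X, |(φ X ^ 2 - Ψ₀ X ^ 2) * w X| ≤ B * (2 * M) * s := by
    intro X
    rw [abs_mul, show φ X ^ 2 - Ψ₀ X ^ 2 = (φ X - Ψ₀ X) * (φ X + Ψ₀ X) by ring, abs_mul]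
    calc |φ X - Ψ₀ X| * |φ X + Ψ₀ X| * |w X| ≤ s * (M + M) * B := by
          refine mul_le_mul (mul_le_mul (hsup X) ((abs_add_le _ _).trans (add_le_add (hφM X) (hΨM X)))
            (abs_nonneg _) hs0) (hw X) (abs_nonneg _) (mul_nonneg hs0 (by linarith))
      _ = B * (2 * M) * s := by ring
  haveI : IsFiniteMeasure (volume.restrict (cellN N L) : Measure (Config N)) :=
    ⟨by rw [Measure.restrict_apply_univ]; exact (volume_cellN_ne_top N L).lt_top⟩
  calc |∫ X in cellN N L, (φ X ^ 2 - Ψ₀ X ^ 2) * w X| ≤ B * (2 * M) * s * (volume.restrict (cellN N L)).real Set.univ := by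
        rw [← Real.norm_eq_abs]
        refine norm_integral_le_of_norm_le_const (Eventually.of_forall fun X => ?_)
        rw [Real.norm_eq_abs]; exact hpt X
    _ = B * (volume (cellN N L)).toReal * (2 * M) * s := by
        rw [measureReal_def, Measure.restrict_apply_univ]
        ring

/-- **`periodicGroundStateEnergy v N L ≤ λ` from the integrated eigen-relation.** For `L > 0`, a
measurable pair potential with bounded periodisation `v^per ≤ C`, and a continuous, nonnegative,
permutation-symmetric, periodic `Ψ₀` with `∫_cell Ψ₀² = 1` and `e^{-λt} ≤ ⟨Ψ₀, e^{-tH}Ψ₀⟩_cell` for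
all `t > 0`: the symmetric periodic `C¹` trial states built from `ρ_r ⋆ Ψ₀` have energies
eventually below `λ + ε` for every `ε > 0` (Chung–Zhao's Prop 3.29, upper half, in the tree's
periodic variational vocabulary). [cite: ChungZhao1995, Thm 3.27 and Prop 3.29 (81)] -/
theorem periodicGroundStateEnergy_le_ofReal_of_eigen {L : ℝ} (hL : 0 < L) {v : ℝ → ℝ≥0∞} (hv : Measurable v)
    {C : ℝ≥0} (hC : ∀ x, periodizedPotential v L x ≤ C) {Ψ₀ : Config N → ℝ} (hcont : Continuous Ψ₀)
    (hper : ∀ (X : Config N) (i : Fin N) (k : Fin 3),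
      Ψ₀ (X + Pi.single i (EuclideanSpace.single k L)) = Ψ₀ X)
    (hnn : ∀ X, 0 ≤ Ψ₀ X)
    (hsymm : ∀ (σ : Equiv.Perm (Fin N)) (X : Config N), Ψ₀ (X ∘ σ) = Ψ₀ X)
    (hnorm : ∫ X in cellN N L, Ψ₀ X ^ 2 = 1) {lam : ℝ}
    (heig : ∀ t : ℝ, 0 < t → Real.exp (-(lam * t)) ≤ ∫ X in cellN N L, Ψ₀ X * pfkReal v L t Ψ₀ X) :
    periodicGroundStateEnergy v N L ≤ ENNReal.ofReal lam := by
  -- data of `Ψ₀`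
  have hΨm : Measurable Ψ₀ := hcont.measurable
  obtain ⟨M, hMnn, hMabs⟩ := exists_bound_of_continuous_periodic hL hcont hper
  have hΨsq : Integrable (fun X => Ψ₀ X ^ 2) (volume.restrict (cellN N L)) :=
    (memLp_two_cellN_of_bound L hΨm hMabs).integrable_sq
  set Pot : ℝ := ∫ X in cellN N L, Ψ₀ X ^ 2 * (periodicInteraction v L X).toReal with hPotdef
  have hPot0 : 0 ≤ Pot := integral_nonneg fun X => mul_nonneg (sq_nonneg _) ENNReal.toReal_nonneg
  have hPotle : Pot ≤ lam := setIntegral_cellN_sq_mul_periodicInteraction_le hv hL hC hcont hper hnn hnorm heig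
  have hlam0 : 0 ≤ lam := hPot0.trans hPotle
  -- the bounded weight `V^per.toReal ≤ N²C`
  set CV : ℝ := ((N * N : ℕ) : ℝ) * C with hCVdef
  have hCV0 : 0 ≤ CV := by positivity
  have hVreal : ∀ X : Config N, |(periodicInteraction v L X).toReal| ≤ CV := fun X => by
    rw [abs_of_nonneg ENNReal.toReal_nonneg]
    have h1 := periodicInteraction_le_of_bound (C := (C : ℝ≥0∞)) (fun x => hC x) X
    have h2 : ((N * N : ℕ) : ℝ≥0∞) * (C : ℝ≥0∞) ≠ ⊤ := ENNReal.mul_ne_top (ENNReal.natCast_ne_top _) ENNReal.coe_ne_top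
    have := ENNReal.toReal_mono h2 h1
    rw [ENNReal.toReal_mul] at this
    simpa [hCVdef] using this
  set vol : ℝ := (volume (cellN N L)).toReal with hvoldef
  have hvol0 : 0 ≤ vol := ENNReal.toReal_nonneg
  -- `ε`-management
  refine ENNReal.le_of_forall_pos_le_add fun ε hε _ => ?_
  set η : ℝ := min ((ε : ℝ) / 4) (1 / 4) with hηdef
  have hε' : (0 : ℝ) < ε := by exact_mod_cast hε
  have hη : 0 < η := lt_min (by linarith) (by norm_num)
  have hη4 : 4 * η ≤ ε := by have := min_le_left ((ε : ℝ) / 4) (1 / 4); linarith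
  have hη1 : η ≤ 1 / 4 := min_le_right _ _
  set K' : ℝ := lam - Pot + η with hK'def
  have hK' : lam - Pot < K' := by rw [hK'def]; linarith
  have hK'0 : 0 ≤ K' := by rw [hK'def]; linarith
  have hev := sqIncrCell_div_eventually_le hv hL hC hcont hper hnn hnorm heig hK'
  set τ : ℝ := η / (lam + 4 * η + 1) with hτdef
  have hτ : 0 < τ := div_pos hη (by linarith)
  have hτη : τ ≤ η := by
    rw [hτdef, div_le_iff₀ (by linarith)]; nlinarith
  have hτlam : τ * (lam + 4 * η) ≤ η := by
    rw [hτdef]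
    rw [div_mul_eq_mul_div, div_le_iff₀ (by linarith)]
    nlinarith
  set s : ℝ := τ / ((CV + 1) * (vol + 1) * (2 * M + 1)) with hsdef
  have hs : 0 < s := div_pos hτ (by positivity)
  have hsB : ∀ B : ℝ, 0 ≤ B → B ≤ CV + 1 → B * vol * (2 * M) * s ≤ τ := by
    intro B hB0 hB1
    have hden : 0 < (CV + 1) * (vol + 1) * (2 * M + 1) := by positivity
    have : B * vol * (2 * M) * s = τ * (B * vol * (2 * M) / ((CV + 1) * (vol + 1) * (2 * M + 1))) := by
      simp only [hsdef]; field_simp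
    rw [this]
    calc τ * (B * vol * (2 * M) / ((CV + 1) * (vol + 1) * (2 * M + 1))) ≤ τ * 1 := by
          refine mul_le_mul_of_nonneg_left ((div_le_one hden).2 ?_) hτ.le
          calc B * vol * (2 * M) ≤ (CV + 1) * vol * (2 * M) := by gcongr
            _ ≤ (CV + 1) * (vol + 1) * (2 * M + 1) := by gcongr <;> linarith
      _ = τ := mul_one τ
  -- choose the mollification radius
  obtain ⟨r₀, hr₀, hunif⟩ := abs_mollify_sub_le_of_periodic hL hcont hper hs
  set r : ℝ := r₀ with hrdef
  have hr : 0 < r := hr₀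
  have hu : ∀ X, |mollify hr Ψ₀ X - Ψ₀ X| ≤ s := hunif r hr le_rfl
  -- the trial function at this `r`
  set φ := mollify hr Ψ₀ with hφdef
  have hφC : ContDiff ℝ 1 φ := contDiff_mollify hr hcont.locallyIntegrable
  have hφm : Measurable φ := hφC.continuous.measurable
  have hφM : ∀ X, |φ X| ≤ M := abs_mollify_le hr hMabs
  have hφper : ∀ (X : Config N) (i : Fin N) (k : Fin 3),
      φ (X + Pi.single i (EuclideanSpace.single k L)) = φ X := mollify_periodic hr hper
  have hφsq : Integrable (fun X => φ X ^ 2) (volume.restrict (cellN N L)) :=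
    (memLp_two_cellN_of_bound L hφm hφM).integrable_sq
  -- the norm and the potential energy are close to `1` and `Pot`
  have hn1 : |(∫ X in cellN N L, φ X ^ 2) - 1| ≤ τ := by
    have heq : (∫ X in cellN N L, φ X ^ 2) - 1 = ∫ X in cellN N L, (φ X ^ 2 - Ψ₀ X ^ 2) * (fun _ => (1 : ℝ)) X := by
      simp only [mul_one]
      rw [integral_sub hφsq hΨsq, hnorm]
    rw [heq]
    refine (abs_setIntegral_cellN_sq_sub_sq_mul_le (B := 1) hs.le hφM hMabs (fun _ => by norm_num) hu).trans ?_
    exact hsB 1 zero_le_one (by linarith)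
  set PotV : ℝ := ∫ X in cellN N L, φ X ^ 2 * (periodicInteraction v L X).toReal with hPotVdef
  have hPV : |PotV - Pot| ≤ τ := by
    have hint1 : Integrable (fun X => φ X ^ 2 * (periodicInteraction v L X).toReal) (volume.restrict (cellN N L)) := by
      refine (hφsq.mul_const CV).mono' ((hφm.pow_const 2).mul
        (measurable_periodicInteraction hv L).ennreal_toReal).aestronglyMeasurable (Eventually.of_forall fun X => ?_)
      rw [Real.norm_eq_abs, abs_mul, abs_of_nonneg (sq_nonneg _)]
      exact mul_le_mul_of_nonneg_left (hVreal X) (sq_nonneg _)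
    have hint2 : Integrable (fun X => Ψ₀ X ^ 2 * (periodicInteraction v L X).toReal) (volume.restrict (cellN N L)) := by
      refine (hΨsq.mul_const CV).mono' ((hΨm.pow_const 2).mul
        (measurable_periodicInteraction hv L).ennreal_toReal).aestronglyMeasurable (Eventually.of_forall fun X => ?_)
      rw [Real.norm_eq_abs, abs_mul, abs_of_nonneg (sq_nonneg _)]
      exact mul_le_mul_of_nonneg_left (hVreal X) (sq_nonneg _)
    have heq : PotV - Pot = ∫ X in cellN N L, (φ X ^ 2 - Ψ₀ X ^ 2) * (periodicInteraction v L X).toReal := by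
      rw [hPotVdef, hPotdef, ← integral_sub hint1 hint2]
      refine integral_congr_ae (Eventually.of_forall fun X => ?_)
      ring
    rw [heq]
    refine (abs_setIntegral_cellN_sq_sub_sq_mul_le hs.le hφM hMabs hVreal hu).trans ?_
    exact hsB CV hCV0 (by linarith)
  -- positivity of the norm and the trial state
  have hn0 : 0 < ∫ X in cellN N L, φ X ^ 2 := by
    have := (abs_le.1 hn1).1; linarith
  set c : ℝ := (Real.sqrt (∫ X in cellN N L, φ X ^ 2))⁻¹ with hc
  have hc2 : c ^ 2 = (∫ X in cellN N L, φ X ^ 2)⁻¹ := by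
    rw [hc, inv_pow, Real.sq_sqrt hn0.le]
  have hnormΨ : ∫⁻ X in cellN N L, ((‖((c * φ X : ℝ) : ℂ)‖₊ : ℝ≥0∞)) ^ 2 = 1 := by
    have h1 : ∀ X, ((‖((c * φ X : ℝ) : ℂ)‖₊ : ℝ≥0∞)) ^ 2 =
        ENNReal.ofReal (c ^ 2) * ENNReal.ofReal (φ X ^ 2) := fun X => by
      rw [ennnorm_sq_ofReal_periodic, mul_pow, ENNReal.ofReal_mul (sq_nonneg _)]
    simp_rw [h1]
    rw [lintegral_const_mul' _ _ ENNReal.ofReal_ne_top,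
      ← ofReal_integral_eq_lintegral_ofReal hφsq (Eventually.of_forall fun X => sq_nonneg _),
      ← ENNReal.ofReal_mul (sq_nonneg _), hc2, inv_mul_cancel₀ hn0.ne', ENNReal.ofReal_one]
  let Ψ : PeriodicTrialState N L :=
    { ψ := fun X => (((c * φ X : ℝ)) : ℂ)
      contDiff := Complex.ofRealCLM.contDiff.comp (contDiff_const.mul hφC)
      periodic := fun X i k => by
        show (((c * φ (X + Pi.single i (EuclideanSpace.single k L)) : ℝ)) : ℂ) = (((c * φ X : ℝ)) : ℂ)
        rw [hφper]
      symm := fun σ X => by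
        show (((c * φ (X ∘ σ) : ℝ)) : ℂ) = (((c * φ X : ℝ)) : ℂ)
        rw [hφdef, mollify_comp_perm hr hsymm σ X]
      norm_eq := hnormΨ }
  -- the kinetic bound
  have hkin : ∫⁻ X in cellN N L, realKinetic φ X ≤ ENNReal.ofReal K' :=
    setLIntegral_cellN_realKinetic_mollify_le hL hr hcont hper hMabs hev
  have hpotE : ∫⁻ X in cellN N L, ENNReal.ofReal (φ X ^ 2) * periodicInteraction v L X = ENNReal.ofReal PotV :=
    setLIntegral_cellN_sq_mul_periodicInteraction_eq_ofReal hv hC hφm hφsq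
  have hPotV0 : 0 ≤ PotV := integral_nonneg fun X => mul_nonneg (sq_nonneg _) ENNReal.toReal_nonneg
  -- the energy bound in `[0, ∞]`
  have hE : periodicEnergy v Ψ ≤ ENNReal.ofReal ((∫ X in cellN N L, φ X ^ 2)⁻¹ * (K' + PotV)) := by
    rw [periodicEnergy_of_ofReal_mul Ψ hφC rfl v, hpotE, hc2,
      ENNReal.ofReal_mul (inv_nonneg.2 hn0.le), ENNReal.ofReal_add hK'0 hPotV0]
    gcongr
  -- the real inequality
  have hreal : (∫ X in cellN N L, φ X ^ 2)⁻¹ * (K' + PotV) ≤ lam + ε := by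
    set n := ∫ X in cellN N L, φ X ^ 2 with hndef
    have hn_low : 1 - τ ≤ n := by have := (abs_le.1 hn1).1; linarith
    have hPVle : PotV ≤ Pot + τ := by have := (abs_le.1 hPV).2; linarith
    rw [inv_mul_le_iff₀ hn0]
    have h1 : K' + PotV ≤ lam + 2 * η := by rw [hK'def]; linarith
    have h2 : lam + 2 * η ≤ n * (lam + 4 * η) := by nlinarith
    nlinarith
  calc periodicGroundStateEnergy v N L ≤ periodicEnergy v Ψ := periodicGroundStateEnergy_le v Ψ
    _ ≤ ENNReal.ofReal ((∫ X in cellN N L, φ X ^ 2)⁻¹ * (K' + PotV)) := hE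
    _ ≤ ENNReal.ofReal (lam + ε) := ENNReal.ofReal_le_ofReal hreal
    _ ≤ ENNReal.ofReal lam + ENNReal.ofReal ε := ENNReal.ofReal_add_le
    _ = ENNReal.ofReal lam + ε := by rw [ENNReal.ofReal_coe_nnreal]

/-! ### The identification -/

/-- **The variational identification `periodicGroundStateEnergy v N L = λ`** (Chung–Zhao (1995)
Thm 3.27 with Prop 3.29 (81), in the tree's periodic variables). Let `L > 0`, `v` a measurable
pair potential with bounded periodisation `v^per ≤ C`, and `λ ∈ ℝ` such that
(i) the torus Feynman–Kac semigroup obeys the Rayleigh bound `⟨f, e^{-tH}f⟩_cell ≤ e^{-λt}‖f‖²_cell`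
for all `t > 0` and all periodic `C¹` real `f` (true when `e^{-λ}` is the top of the spectrum of
`e^{-H}` on `L²(cell)`), and
(ii) some continuous, nonnegative, permutation-symmetric periodic `Ψ₀` with `∫_cell Ψ₀² = 1`
satisfies `e^{-λt} ≤ ⟨Ψ₀, e^{-tH}Ψ₀⟩_cell` for all `t > 0` (true for the normalised
Perron–Frobenius eigenfunction).
Then the variational periodic ground-state energy over the symmetric periodic `C¹` core equals `λ`:
`periodicGroundStateEnergy v N L = ENNReal.ofReal λ`, and `0 ≤ λ`.
[cite: ChungZhao1995, Thm 3.27 and Prop 3.29 (81)] -/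
theorem periodicGroundStateEnergy_eq_ofReal_of_feynmanKac {L : ℝ} (hL : 0 < L) {v : ℝ → ℝ≥0∞} (hv : Measurable v)
    {C : ℝ≥0} (hC : ∀ x, periodizedPotential v L x ≤ C) {lam : ℝ}
    (htop : ∀ f : Config N → ℝ, ContDiff ℝ 1 f →
      (∀ (X : Config N) (i : Fin N) (k : Fin 3),
        f (X + Pi.single i (EuclideanSpace.single k L)) = f X) →
      ∀ t : ℝ, 0 < t →
        ∫ X in cellN N L, f X * pfkReal v L t f X ≤ Real.exp (-(lam * t)) * ∫ X in cellN N L, f X ^ 2)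
    {Ψ₀ : Config N → ℝ} (hcont : Continuous Ψ₀)
    (hper : ∀ (X : Config N) (i : Fin N) (k : Fin 3),
      Ψ₀ (X + Pi.single i (EuclideanSpace.single k L)) = Ψ₀ X)
    (hnn : ∀ X, 0 ≤ Ψ₀ X) (hsymm : ∀ (σ : Equiv.Perm (Fin N)) (X : Config N), Ψ₀ (X ∘ σ) = Ψ₀ X)
    (hnorm : ∫ X in cellN N L, Ψ₀ X ^ 2 = 1)
    (heig : ∀ t : ℝ, 0 < t → Real.exp (-(lam * t)) ≤ ∫ X in cellN N L, Ψ₀ X * pfkReal v L t Ψ₀ X) :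
    periodicGroundStateEnergy v N L = ENNReal.ofReal lam ∧ 0 ≤ lam := by
  have hle := periodicGroundStateEnergy_le_ofReal_of_eigen hL hv hC hcont hper hnn hsymm hnorm heig
  have hge := ofReal_le_periodicGroundStateEnergy_of_pairing_le hL hv hC htop
  have hPot0 : 0 ≤ ∫ X in cellN N L, Ψ₀ X ^ 2 * (periodicInteraction v L X).toReal :=
    integral_nonneg fun X => mul_nonneg (sq_nonneg _) ENNReal.toReal_nonneg
  exact ⟨le_antisymm hle hge,
    hPot0.trans (setIntegral_cellN_sq_mul_periodicInteraction_le hv hL hC hcont hper hnn hnorm heig)⟩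

/-- Under the hypotheses of `periodicGroundStateEnergy_eq_ofReal_of_feynmanKac`: the variational periodic
ground-state energy is finite and `(periodicGroundStateEnergy v N L).toReal = λ`.
[cite: ChungZhao1995, Prop 3.29 (81)] -/
theorem periodicGroundStateEnergy_toReal_eq_of_feynmanKac {L : ℝ} (hL : 0 < L) {v : ℝ → ℝ≥0∞} (hv : Measurable v)
    {C : ℝ≥0} (hC : ∀ x, periodizedPotential v L x ≤ C) {lam : ℝ}
    (htop : ∀ f : Config N → ℝ, ContDiff ℝ 1 f →
      (∀ (X : Config N) (i : Fin N) (k : Fin 3),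
        f (X + Pi.single i (EuclideanSpace.single k L)) = f X) →
      ∀ t : ℝ, 0 < t →
        ∫ X in cellN N L, f X * pfkReal v L t f X ≤ Real.exp (-(lam * t)) * ∫ X in cellN N L, f X ^ 2)
    {Ψ₀ : Config N → ℝ} (hcont : Continuous Ψ₀)
    (hper : ∀ (X : Config N) (i : Fin N) (k : Fin 3),
      Ψ₀ (X + Pi.single i (EuclideanSpace.single k L)) = Ψ₀ X)
    (hnn : ∀ X, 0 ≤ Ψ₀ X) (hsymm : ∀ (σ : Equiv.Perm (Fin N)) (X : Config N), Ψ₀ (X ∘ σ) = Ψ₀ X)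
    (hnorm : ∫ X in cellN N L, Ψ₀ X ^ 2 = 1)
    (heig : ∀ t : ℝ, 0 < t → Real.exp (-(lam * t)) ≤ ∫ X in cellN N L, Ψ₀ X * pfkReal v L t Ψ₀ X) :
    periodicGroundStateEnergy v N L ≠ ⊤ ∧ (periodicGroundStateEnergy v N L).toReal = lam := by
  obtain ⟨heq, hlam⟩ := periodicGroundStateEnergy_eq_ofReal_of_feynmanKac hL hv hC htop hcont hper hnn hsymm hnorm heig
  rw [heq]
  exact ⟨ENNReal.ofReal_ne_top, ENNReal.toReal_ofReal hlam⟩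

end Literature.MathematicalPhysics.QuantumManyBody.BoseGas

end
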